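import Summits.BirchSwinnertonDyer.BirchSwinnertonDyer.Theorems.SignedLowerHalvesKobayashiMainConjectureSmallImageRationalRigidity
import HarnessLib

/-!
# Route `SignedLowerHalves`, crux `KobayashiMainConjectureSmallImage` (item stmt-BirchSwinnertonDyer-19002):
# the anticyclotomic ANCHOR is also needed only RATIONALLY — `(G⁻)` is saturated under nonzero constants once
# `μ(G⁻) = 0` (cell `bsd-ssimc`, seat `bsd-line-slh-p3` gen 6, line `birth_acns`; THEOREMS ONLY, route-independent
# algebra; helper `--supports` item 4; after the ideator bsd-idea-13 g5's crux workfile `RatAnchorSaturation.lean`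
# commit 2107a04860e2, re-landed here in citable `Theorems` form, ideal-theoretic statements)

Companion of `…SmallImageRationalRigidity.lean` (p625973: `β·G ∈ I` + INTEGRAL anchor `I|_{T₁=0} ⊆ (G⁻)` + `μ(G⁻) = 0`
⇒ `I ⊆ (G)`). Here the anchor too is fed UP TO A NONZERO CONSTANT: `(β')·I|_{T₁=0} ⊆ (G⁻)` (e.g. `β' = p^b`, the
shape a Λ-adic Kolyvagin-system argument run at prime-to-`p` image produces — bounded, not zero, error terms).
Mechanism: ONE application of the one-variable Gauss inequality (`SmallImageGaussInequality.norm_coeff_mul_norm_coeff_le₁`,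
p625484): `β'·x = G⁻·m` ⇒ every coefficient of `G⁻·m` has norm `≤ ‖β'‖` ⇒ (unit coefficient of `G⁻`) `‖m_n‖ ≤ ‖β'‖`
⇒ `β' ∣ m` in the valuation ring `𝒪_{ℂ_p}` ⇒ `x ∈ (G⁻)`.

* `dvd_of_dvd_C_mul_of_hasUnitContent` / `le_span_of_span_C_mul_le` / `le_span_of_span_natCast_pow_mul_le` —
  SATURATION of `(G₀)` in `𝒪_{ℂ_p}⟦T⟧` under nonzero constants when `μ(G₀) = 0`;
* `map_le_span_of_anchorRat_natCast_pow` — the K1″-receptacle rigidity with BOTH engine inclusions rational: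
  `(p^a·G) ⊆ I·𝒪⟦T₁,T₂⟧`, `(p^b)·(I·𝒪⟦T₁,T₂⟧)|_{T₁=0} ⊆ (G⁻)`, `μ(G⁻) = 0` ⇒ `I·𝒪⟦T₁,T₂⟧ ⊆ (G)`.

READING for line `birth_acns` (v4): at `p ≥ 5` NEITHER engine stub (T1, T2) has to be integral; the by-name fact
`μ(𝓛_p^{Gr}(f/K)⁻) = 0` (BCS 2025 Prop. 4.2.2, already an input of the composition) absorbs every `p`-power ambiguity
of the small-image Euler/Kolyvagin-system arguments. HONEST SCOPE: pure commutative algebra; nothing about any curve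
is asserted; crux 4 OPEN; BSD is not proved by any of this.

References: [BourbakiAC5to7] Ch. VII §3 (Gauss's lemma over a valuation ring — here via the rescaling inequality);
[Rubin2000] Thm. 2.3.3; [BurungaleCastellaSkinner2025] Prop. 4.2.2; tree: ideator workfile
`Cruxes/KobayashiMainConjectureSmallImage/RatAnchorSaturation.lean` (bsd-idea-13 g5, the element-wise statements).
-/

-- D-0017: single-problem summit, the namespace repeats the problem name by design.
set_option linter.dupNamespace false
set_option autoImplicit false

noncomputable section

open scoped Classical

namespace Summit.BirchSwinnertonDyer.BirchSwinnertonDyer.Theorems.SmallImageRationalAnchor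

open PowerSeries Literature.NumberTheory.EllipticCurves Literature.NumberTheory.EllipticCurves.GreenbergVatsal2000
  Literature.NumberTheory.EllipticCurves.UnrSeries₂
  Summit.BirchSwinnertonDyer.BirchSwinnertonDyer.Theorems.SmallImageGaussInequality
  Summit.BirchSwinnertonDyer.BirchSwinnertonDyer.Theorems.SmallImageRationalRigidity

variable {p : ℕ} [Fact p.Prime]

/-! ## §1 Saturation of `(G₀)` under nonzero constants when `μ(G₀) = 0` -/

/-- **Cancellation of a nonzero constant against a series of unit content.** In `𝒪_{ℂ_p}⟦T⟧`: if `G₀` has UNIT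
CONTENT, `β' ≠ 0` is a constant and `G₀ ∣ β'·x`, then `G₀ ∣ x`: with `β' x = G₀ m` the one-variable Gauss
inequality at a unit coefficient of `G₀` gives `‖m_n‖ ≤ ‖β'‖` for all `n`, so `β' ∣ m`. (Element form of the
ideator's `RatAnchorSaturation.mem_span_of_C_mul_mem_span`.) [folklore]
[cite: BourbakiAC5to7, Ch. VII §3 (Gauss's lemma over a valuation ring)] -/
theorem dvd_of_dvd_C_mul_of_hasUnitContent {G₀ x : PowerSeries (PadicComplexInt p)} (hμ : HasUnitContent G₀)
    {β' : PadicComplexInt p} (hβ' : β' ≠ 0) (hx : G₀ ∣ C β' * x) : G₀ ∣ x := by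
  obtain ⟨m, hm⟩ := hx
  -- hm : C β' * x = G₀ * m
  obtain ⟨n₀, hn₀⟩ := hμ
  have hb : ∀ j, ‖((coeff j (G₀ * m) : PadicComplexInt p) : ℂ_[p])‖ ≤ ‖(β' : ℂ_[p])‖ := by
    intro j
    rw [← hm, coeff_C_mul]
    push_cast
    rw [norm_mul]
    exact mul_le_of_le_one_right (norm_nonneg _) (norm_coe_padicComplexInt_le_one _)
  have key : ∀ n, ‖((coeff n m : PadicComplexInt p) : ℂ_[p])‖ ≤ ‖(β' : ℂ_[p])‖ := by
    intro n
    have h1 := norm_coeff_mul_norm_coeff_le₁ G₀ m hb n₀ n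
    rwa [isUnit_padicComplexInt_iff.mp hn₀, one_mul] at h1
  have hdvd : ∀ n, β' ∣ coeff n m := fun n ↦ padicComplexInt_dvd_of_norm_le (key n)
  choose q hq using hdvd
  have hmm' : m = C β' * PowerSeries.mk q := by
    refine PowerSeries.ext fun n ↦ ?_
    rw [coeff_C_mul, coeff_mk]
    exact hq n
  have hC : (C β' : PowerSeries (PadicComplexInt p)) ≠ 0 := by
    intro h0
    apply hβ'
    simpa using congr_arg (constantCoeff (R := PadicComplexInt p)) h0
  have e1 : C β' * x = C β' * (G₀ * PowerSeries.mk q) := by rw [hm, hmm']; ring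
  exact ⟨PowerSeries.mk q, mul_left_cancel₀ hC e1⟩

/-- **Saturation, ideal form**: `(C β') · 𝔞 ⊆ (G₀)` with `β' ≠ 0` and `μ(G₀) = 0` implies `𝔞 ⊆ (G₀)`. [folklore]
[cite: BourbakiAC5to7, Ch. VII §3 (Gauss's lemma)] -/
theorem le_span_of_span_C_mul_le {𝔞 : Ideal (PowerSeries (PadicComplexInt p))}
    {G₀ : PowerSeries (PadicComplexInt p)} (hμ : HasUnitContent G₀) {β' : PadicComplexInt p} (hβ' : β' ≠ 0)
    (h : Ideal.span {C β'} * 𝔞 ≤ Ideal.span {G₀}) : 𝔞 ≤ Ideal.span {G₀} := fun _ hx ↦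
  Ideal.mem_span_singleton.mpr (dvd_of_dvd_C_mul_of_hasUnitContent hμ hβ'
    (Ideal.mem_span_singleton.mp (h (Ideal.mul_mem_mul (Ideal.mem_span_singleton_self _) hx))))

/-- **Saturation, `p^b`-form** (the text a small-image Kolyvagin-system bound produces): `(p^b) · 𝔞 ⊆ (G₀)`,
`μ(G₀) = 0` ⇒ `𝔞 ⊆ (G₀)`. [folklore] [cite: BourbakiAC5to7, Ch. VII §3 (Gauss's lemma)] -/
theorem le_span_of_span_natCast_pow_mul_le {𝔞 : Ideal (PowerSeries (PadicComplexInt p))}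
    {G₀ : PowerSeries (PadicComplexInt p)} (hμ : HasUnitContent G₀) (b : ℕ)
    (h : Ideal.span {((p : ℕ) : PowerSeries (PadicComplexInt p)) ^ b} * 𝔞 ≤ Ideal.span {G₀}) :
    𝔞 ≤ Ideal.span {G₀} := by
  have hβ : (p : PadicComplexInt p) ^ b ≠ 0 := pow_ne_zero _ natCast_p_ne_zero
  have hC : (C ((p : PadicComplexInt p) ^ b) : PowerSeries (PadicComplexInt p)) =
      ((p : ℕ) : PowerSeries (PadicComplexInt p)) ^ b := by
    rw [map_pow, map_natCast]
  exact le_span_of_span_C_mul_le hμ hβ (hC ▸ h)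

/-! ## §2 Rigidity with BOTH engine inclusions rational -/

/-- **Doubly-rational rigidity in the K1″ receptacle.** For a principal ideal `I ⊆ Λ_K = ℤ_p⟦T₂⟧⟦T₁⟧` and a
structure map `J`: the RATIONAL Euler-system inclusion `(p^a·G) ⊆ I·𝒪⟦T₁,T₂⟧`, the RATIONAL anticyclotomic
anchor `(p^b)·(I·𝒪⟦T₁,T₂⟧)|_{T₁=0} ⊆ (G⁻)` and `μ(G⁻) = 0` (`HasUnitContent (minus G)`, the form in which BCS
2025 Prop. 4.2.2 is consumed) give the integral Eisenstein inclusion `I·𝒪⟦T₁,T₂⟧ ⊆ (G)`: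
`SmallImageRationalRigidity.map_le_span_of_anchor_natCast_pow` (the case `b = 0`) after saturation (§1).
[cite: Rubin2000, Thm. 2.3.3 (the p^t-shape of Euler/Kolyvagin-system bounds without the τ-hypothesis)]
[cite: BurungaleCastellaSkinner2025, Prop. 4.2.2 (§4.2, p. 9 of arXiv:2405.00270v2) (the μ-input by name)]
[cite: BurungaleSkinnerTianWan2024, Thm. 9.24 (the Eisenstein-direction conclusion shape of K1″)] -/
theorem map_le_span_of_anchorRat_natCast_pow {I : Ideal (IwasawaAlgebra₂ p)} (hI : I.IsPrincipal)
    (J : ℤ_[p] →+* PadicComplexInt p) {G : PowerSeries (PowerSeries (PadicComplexInt p))} (a b : ℕ)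
    (hES : Ideal.span {((p : ℕ) : PowerSeries (PowerSeries (PadicComplexInt p))) ^ a * G} ≤
      I.map (IwasawaAlgebra₂.toUnr₂ p J))
    (hμ : HasUnitContent (UnrSeries₂.minus G))
    (hanch : Ideal.span {((p : ℕ) : PowerSeries (PadicComplexInt p)) ^ b} *
        (I.map (IwasawaAlgebra₂.toUnr₂ p J)).map
          (PowerSeries.constantCoeff (R := PowerSeries (PadicComplexInt p))) ≤
      Ideal.span {UnrSeries₂.minus G}) :
    I.map (IwasawaAlgebra₂.toUnr₂ p J) ≤ Ideal.span {G} :=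
  map_le_span_of_anchor_natCast_pow hI J a hES hμ (le_span_of_span_natCast_pow_mul_le hμ b hanch)

end Summit.BirchSwinnertonDyer.BirchSwinnertonDyer.Theorems.SmallImageRationalAnchor

end
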